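import Summits.QuantumFields.BalabanUV.T4Continuum.Spine.NE7.QLaTorusB7Averaging
import Summits.QuantumFields.BalabanUV.T4Continuum.Spine.NE7.QLaFlatAveragingLip
import Summits.QuantumFields.BalabanUV.T4Continuum.Spine.NE7.QLaFlatAveragingShift
import Literature.MathematicalPhysics.QuantumFieldTheory.Balaban1983to89.B9Eq315QLipschitz
import Literature.MathematicalPhysics.QuantumFieldTheory.Balaban1983to89.T4AvgSensitivity

/-!
# Spine/NE7/QLaTorusIterate — on the small-field polydisc the iterates of the torus averaging `avgB7` ARE Bałaban's double-bar
# iterates (90)–(91) up to an accumulated UNITARY, PERIODIC gauge transformation ((159) p. 42 in Setup's centred convention),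
# every guard being met: the unitarity∕smallness induction and the lift of `iterFrom`

Cell `pub-balaban-gaps` (YM blitz Y1, track G2, seat `ne7`, generation 6); text of record
`run/shared/lean/pub/pub-balaban-gaps/ne/NE7.md` v6 §4septies, census rows R39 (half (b)) ∕ R45 (fork (b-i)) ∕ R46.  Nineteenth
`Spine/NE7/` file; imports files 18 (`QLaTorusB7Averaging`: `cstep`, `avgB7`, `liftCfg_avgB7`), 14 (`QLaFlatAveragingLip`, for b07's
`B7Prop4Flat`∕`B7Prop5Flat` and file 11's `smallness_of_C3`), 15 (`QLaFlatAveragingShift`: `vframe_shift`, `isPeriodic_dbavgIter`) and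
the b09 leaf `B9Eq315QLipschitz` (`norm_hol_sub_one_le`: `‖V(Γ) − 1‖ ≤ |Γ|·ε`), all consumed BY NAME.

WHY.  File 20 proves `FramedBondLip (avgB7 P N) dom Cb θ` by transporting file 14's one-bond Lipschitz bound for b07's `dbavgIter`
(the `k`-fold double-bar average (90)–(91) at `U₀ = 1`) to the torus; for that the `n`-fold iterate of the TORUS averaging must be
identified, up to a gauge transformation (the frame map of `FramedBondLip`), with `dbavgIter` of the lift.  [Balaban1985Averaging]
(159) p. 42: «Ū^k_b(Ū^k_0)_b⁻¹ = … = v_k(b₋)(U̿′^k)_b R̄^k_{0,b} v_k⁻¹(b₊)» — the plain `k`-fold average IS the gauge transform of the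
double-bar one by the accumulated block frames (160); b07's `B7Prop6Flat.avgIter_eq_gaugeAct_vprod` is this identity for the CORNER
convention.  Here the same is proved for the centre-covariant guarded step of file 18, with the accumulated gauge `gacc` absorbing
ALSO the centre-to-corner transports, and — the point — with every factor UNITARY and every guard TRUE on the polydisc, which needs
the smallness of b07's Proposition 4 ((131) = (161): `‖Q_j‖ ≤ 2L^jb`) and (22)–(23) p. 21 (logarithms of unitaries near `1` are
skew-adjoint ⟹ the block frames (110) are unitary).

WHAT IS HERE.  §1 `citer W i` (iterated step), `gacc W i` (`g_0 = 1`, `g_{i+1}(z) = τ_{W_i}(z)·g_i(Lz)·v[U̿^i](Lz)`), their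
`U(N)`-valuedness and descent to the tori (`citer_periodic`, `gacc_periodic`: period divided by `L` per step).  §2 `norm_dbavgIter_sub_one_le`:
for `sup‖B‖ ≤ b`, `C₃L^nb ≤ 1`, `i ≤ n`, every bond variable of `U̿^i[e^B]` is within `4L^nb` of `1` (b07's `prop4_flat_induction` +
`‖e^X − 1‖ ≤ 2‖X‖`); `small_of_C3`: the two numerical consequences `dL·4L^nb ≤ 1/4`, `2(d+1)L·4L^nb ≤ 1/4` (`C₃ ≥ 32(d+1)L`).  §3
`guard_of_small` (the guard of file 18 holds when bond variables are within `δ` of `1`, `2(d+1)Lδ ≤ 1/4`), `vframe_mem` (the block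
frame (110) of a `U(N)`-valued configuration with `dLδ ≤ 1/4` is unitary), and the induction `citer_eq_gaugeAct_dbavgIter`: for
`e^B` `U(N)`-valued in the polydisc and every `i ≤ n`, (a) `U̿^i` is `U(N)`-valued, (b) `g_i` is `U(N)`-valued, (c)
`citer (e^B) i = (U̿^i)^{g_i}` (b07's `bavg_gaugeAct_units` (45) and `bavg_eq_conj_dbavg` (92) inside a guard certified by §2).  §4
`liftCfg_iterFrom`: `(iterFrom avgB7 k n V)~ = citer Ṽ n` (file 18's `liftCfg_avgB7` iterated in the standing range).  §5 the
OBJECTS of file 20's `FramedBondLip` instance (definitions only, so that file 20 is proof-only): the domain radius `rho P k =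
1/(2C₃L^{m+K−k})`, the sup-ball domain family `dom`, the logarithmic coordinates `logCfg V = log Ṽ`, `toG` (a unit read in `U(N)`),
and the frame map `frB7 k n V = (g_n[Ṽ] ∘ tlift)⁻¹`.

HONEST FRAMING.  [folklore] bookkeeping over b07's kernel theorems (Props. 3–4 at `U₀ = 1`, (45), (92)) and b09's holonomy bound;
the smallness regime is b07's polydisc `C₃L^nb ≤ 1` (Bałaban-style non-optimal constants, census R44); nothing of the (1.100)
insert, of (QL-a) or of NE7 is asserted: (QL-a) NOT IN PRINT; NE7 NOT proved; spine 0∕9; fixed finite T⁴ — NOT ℝ⁴, NOT infinite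
volume, NOT a mass gap, NOT Clay.
-/

noncomputable section

open scoped BigOperators Matrix.Norms.L2Operator

namespace Summit.QuantumFields.BalabanUV.T4Continuum.Spine.NE7.TorusB7

open Literature.MathematicalPhysics.QuantumFieldTheory.Balaban1983to89
open Literature.MathematicalPhysics.QuantumFieldTheory.Balaban1983to89.B7Prop1Explicit hiding Site
open Literature.MathematicalPhysics.QuantumFieldTheory.Balaban1983to89.B7Prop2Explicit (unitaryUnits mem_unitaryUnits
  bavg_mem_unitaryUnits unitaryUnits_le_U1 hol_mem_of rescale rescale_apply star_mlog_eq_neg)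
open Literature.MathematicalPhysics.QuantumFieldTheory.Balaban1983to89.B7Prop3Flat (Favg vframe dbavg expCfg
  bavg_eq_conj_dbavg C1)
open Literature.MathematicalPhysics.QuantumFieldTheory.Balaban1983to89.B7Prop4Flat (dbavgIter dbavgIter_succ dbavgIter_zero
  logIter prop4_flat_induction C1_pos)
open Literature.MathematicalPhysics.QuantumFieldTheory.Balaban1983to89.B7Prop5Flat (C3 C3_pos)
open Literature.MathematicalPhysics.QuantumFieldTheory.Balaban1983to89.MatrixLog (mlog)
open Literature.MathematicalPhysics.QuantumFieldTheory.Balaban1983to89.T4TermwiseTorus (tcls tcls_apply tcls_add tlift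
  tcls_tlift IsPeriodic)
open Literature.MathematicalPhysics.QuantumFieldTheory.Balaban1983to89.T4AvgSensitivity (iterFrom iterFrom_succ iterFrom_zero)
open Summit.QuantumFields.BalabanUV.T4Continuum.Spine.NE7.B7Flat (smallness_of_C3 vframe_shift isPeriodic_dbavgIter)

variable {P : Params} {N : ℕ}

/-! ## §1 The iterates of the step and the accumulated gauge transformation, on `ℤ^d` -/

variable (P N) in
/-- The `i`-fold iterate of the centre-covariant step of file 18, read on the unit lattices `Ω^{(i)} ≅ ℤ^d` (as b07's `avgIter` (43)). [cite: Balaban1985Averaging, (43) p.24] -/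
def citer (W : (Fin P.d → ℤ) → Fin P.d → (Mat N)ˣ) : ℕ → (Fin P.d → ℤ) → Fin P.d → (Mat N)ˣ
  | 0 => W
  | i + 1 => cstep P N (citer W i)

variable (P N) in
/-- THE ACCUMULATED GAUGE TRANSFORMATION `g_i` relating the iterates of the step to the double-bar iterates (90)–(91):
`g_0 = 1`, `g_{i+1}(z) = τ_{W_i}(z) · g_i(Lz) · v[U̿^i](Lz)` — the centre-to-corner transport of the `i`-th iterate, the previous
accumulated gauge at the corner, and the block frame (110) of the `i`-th double-bar average ((159)–(160) p. 42 in Setup's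
centred convention). [cite: Balaban1985Averaging, (159)–(160) p.42] -/
def gacc (W : (Fin P.d → ℤ) → Fin P.d → (Mat N)ˣ) : ℕ → (Fin P.d → ℤ) → (Mat N)ˣ
  | 0 => fun _ => 1
  | i + 1 => fun z => frameTr P N (citer P N W i) z * gacc W i ((P.L : ℤ) • z) * vframe P.L (dbavgIter P.L W i) ((P.L : ℤ) • z)

/-- `citer W 0 = W`. [folklore] -/
@[simp] theorem citer_zero (W : (Fin P.d → ℤ) → Fin P.d → (Mat N)ˣ) : citer P N W 0 = W := rfl

/-- `citer W (i+1) = cstep (citer W i)`. [folklore] -/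
theorem citer_succ (W : (Fin P.d → ℤ) → Fin P.d → (Mat N)ˣ) (i : ℕ) : citer P N W (i + 1) = cstep P N (citer P N W i) := rfl

/-- `g_0 = 1`. [folklore] -/
@[simp] theorem gacc_zero (W : (Fin P.d → ℤ) → Fin P.d → (Mat N)ˣ) (z : Fin P.d → ℤ) : gacc P N W 0 z = 1 := rfl

/-- `g_{i+1}(z) = τ_{W_i}(z)·g_i(Lz)·v[U̿^i](Lz)` ((160) p. 42, centred convention). [cite: Balaban1985Averaging, (160) p.42] -/
theorem gacc_succ (W : (Fin P.d → ℤ) → Fin P.d → (Mat N)ˣ) (i : ℕ) (z : Fin P.d → ℤ) :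
    gacc P N W (i + 1) z
      = frameTr P N (citer P N W i) z * gacc P N W i ((P.L : ℤ) • z) * vframe P.L (dbavgIter P.L W i) ((P.L : ℤ) • z) := rfl

/-- The iterates of the step are `U(N)`-valued. [folklore] -/
theorem citer_mem {W : (Fin P.d → ℤ) → Fin P.d → (Mat N)ˣ} (hW : ∀ x κ, W x κ ∈ unitaryUnits (Mat N)) :
    ∀ (i : ℕ) (x : Fin P.d → ℤ) (κ : Fin P.d), citer P N W i x κ ∈ unitaryUnits (Mat N)
  | 0, x, κ => hW x κ
  | i + 1, x, κ => cstep_mem (citer_mem hW i) x κ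

/-- The iterates descend to the tori: a `T·L^i`-periodic `W` has a `T`-periodic `i`-th iterate. [cite: Balaban1987RG1, (0.1) p.251] -/
theorem citer_periodic : ∀ (i : ℕ) {T : ℕ} {W : (Fin P.d → ℤ) → Fin P.d → (Mat N)ˣ},
    IsPeriodic (T * P.L ^ i) W → IsPeriodic T (citer P N W i)
  | 0, T, W, hW => by simpa using hW
  | i + 1, T, W, hW => by
    rw [citer_succ]
    refine cstep_periodic (citer_periodic i ?_)
    rwa [mul_assoc, ← pow_succ']

/-- The block frames (110) of a `T`-periodic configuration are `T`-periodic (file 15's `vframe_shift`). [folklore] -/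
theorem vframe_periodic {T : ℕ} {W : (Fin P.d → ℤ) → Fin P.d → (Mat N)ˣ} (hW : IsPeriodic T W) :
    IsPeriodic T (vframe P.L W) := fun q m => by
  have hfun : (fun y ν => W (y + (T : ℤ) • m) ν) = W := funext fun y => funext fun ν => by rw [hW y m]
  rw [← vframe_shift P.L W ((T : ℤ) • m) q, hfun]

/-- The accumulated gauge transformation descends to the coarse torus: a `T·L^i`-periodic `W` has a `T`-periodic `g_i`. [folklore] -/
theorem gacc_periodic : ∀ (i : ℕ) {T : ℕ} {W : (Fin P.d → ℤ) → Fin P.d → (Mat N)ˣ},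
    IsPeriodic (T * P.L ^ i) W → IsPeriodic T (gacc P N W i)
  | 0, T, W, _ => fun z m => rfl
  | i + 1, T, W, hW => by
    have hW' : IsPeriodic ((T * P.L) * P.L ^ i) W := by rwa [mul_assoc, ← pow_succ']
    have h1 : IsPeriodic T (frameTr P N (citer P N W i)) := frameTr_periodic (citer_periodic i hW')
    have h2 : IsPeriodic (T * P.L) (gacc P N W i) := gacc_periodic i hW'
    have h3 : IsPeriodic (T * P.L) (vframe P.L (dbavgIter P.L W i)) :=
      vframe_periodic (isPeriodic_dbavgIter P.L W i (T * P.L) hW')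
    intro z m
    have hLz : (P.L : ℤ) • (z + (T : ℤ) • m) = (P.L : ℤ) • z + ((T * P.L : ℕ) : ℤ) • m := by
      rw [smul_add, smul_smul, Nat.cast_mul, mul_comm (T : ℤ)]
    rw [gacc_succ, gacc_succ, h1 z m, hLz, h2 _ m, h3 _ m]

/-! ## §2 Smallness along the double-bar iteration (b07's Proposition 4 at `U₀ = 1`) -/

section Small

variable {B : (Fin P.d → ℤ) → Fin P.d → Mat N} {b : ℝ} {n : ℕ}

/-- `L ≥ 2` (Setup: `L` odd and `> 1`). [folklore] -/
theorem two_le_L (P : Params) : 2 ≤ P.L := by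
  obtain ⟨hodd, h1⟩ := P.hL
  exact h1

/-- `32(d+1)L ≤ C₃(d,L)` (`C₃ = 128(d+1)C₁L^d`, `C₁ ≥ 1`, `L^d ≥ L`). [folklore] -/
theorem C3_ge (P : Params) : 32 * ((P.d : ℝ) + 1) * P.L ≤ C3 P.d P.L := by
  have hL1 : (1 : ℝ) ≤ P.L := by exact_mod_cast P.L_pos
  have hd : 1 ≤ P.d := P.hd
  have hC1 : (1 : ℝ) ≤ C1 P.d := by
    have : (0 : ℝ) ≤ P.d := Nat.cast_nonneg _
    unfold C1; nlinarith
  have hLd : (P.L : ℝ) ≤ (P.L : ℝ) ^ P.d := by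
    calc (P.L : ℝ) = (P.L : ℝ) ^ 1 := (pow_one _).symm
      _ ≤ (P.L : ℝ) ^ P.d := pow_le_pow_right₀ hL1 hd
  have hd0 : (0 : ℝ) ≤ P.d := Nat.cast_nonneg _
  unfold C3
  calc 32 * ((P.d : ℝ) + 1) * P.L = 32 * ((P.d : ℝ) + 1) * 1 * P.L := by ring
    _ ≤ 128 * ((P.d : ℝ) + 1) * C1 P.d * (P.L : ℝ) ^ P.d := by
      gcongr
      · norm_num

/-- **SUP BOUND ALONG THE DOUBLE-BAR ITERATION** (b07's (131) = (161) `‖Q_i‖ ≤ 2L^ib` with `U̿^i = e^{Q_i}`): for `sup‖B‖ ≤ b`,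
`C₃·L^n·b ≤ 1` and `i ≤ n`, every bond variable of `U̿^i[e^B]` is within `4·L^n·b` of `1`. [cite: Balaban1985Averaging, (131) p.38, (161) p.42] -/
theorem norm_dbavgIter_sub_one_le (hb : 0 ≤ b) (hB : ∀ x κ, ‖B x κ‖ ≤ b) (hn : C3 P.d P.L * ((P.L : ℝ) ^ n * b) ≤ 1)
    {i : ℕ} (hi : i ≤ n) (z : Fin P.d → ℤ) (κ : Fin P.d) :
    ‖((dbavgIter P.L (expCfg B) i z κ : (Mat N)ˣ) : Mat N) - 1‖ ≤ 4 * ((P.L : ℝ) ^ n * b) := by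
  have hL := two_le_L P
  have hL1 : 1 ≤ P.L := P.L_pos
  obtain ⟨hc4, h2b⟩ := smallness_of_C3 P.L hL1 hb n hn
  have hC1 := C1_pos P.d
  have hk8 : 8 * C1 P.d * ((P.L : ℝ) ^ n * b) ≤ 1 := by
    have h := mul_le_mul_of_nonneg_left hc4 (by positivity : (0 : ℝ) ≤ 8 * C1 P.d)
    rwa [B7Prop4Flat.c4, mul_one_div_cancel (by positivity)] at h
  obtain ⟨heq, -, hQ⟩ := prop4_flat_induction P.L hL B hb hB n hk8 i hi
  have hmono : (P.L : ℝ) ^ i * b ≤ (P.L : ℝ) ^ n * b :=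
    mul_le_mul_of_nonneg_right (pow_le_pow_right₀ (by exact_mod_cast hL1) hi) hb
  have hX : ‖logIter P.L B i z κ‖ ≤ 2 * ((P.L : ℝ) ^ n * b) := (hQ z κ).trans (by linarith)
  rw [heq]
  show ‖NormedSpace.exp (logIter P.L B i z κ) - 1‖ ≤ _
  refine (B7Transfer.norm_exp_sub_one_le_of_le _ hX).trans ?_
  have ht0 : 0 ≤ 2 * ((P.L : ℝ) ^ n * b) := by positivity
  have h := Real.abs_exp_sub_one_le (x := 2 * ((P.L : ℝ) ^ n * b)) (by rw [abs_of_nonneg ht0]; linarith)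
  rw [abs_of_nonneg ht0] at h
  have h' := (abs_le.mp h).2
  linarith

/-- The two smallness consequences used below: `(dL)·4L^nb ≤ 1/4` (tree contours) and `2(d+1)L·4L^nb ≤ 1/4` (the loops of the
guard), from `C₃L^nb ≤ 1`. [folklore] -/
theorem small_of_C3 (hb : 0 ≤ b) (hn : C3 P.d P.L * ((P.L : ℝ) ^ n * b) ≤ 1) :
    (P.d * P.L : ℝ) * (4 * ((P.L : ℝ) ^ n * b)) ≤ 1 / 4 ∧
      2 * ((P.d : ℝ) + 1) * P.L * (4 * ((P.L : ℝ) ^ n * b)) ≤ 1 / 4 := by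
  have h := C3_ge P
  have ht : 0 ≤ (P.L : ℝ) ^ n * b := by positivity
  have hd0 : (0 : ℝ) ≤ P.d := Nat.cast_nonneg _
  have hL0 : (0 : ℝ) ≤ P.L := Nat.cast_nonneg _
  have h1 : 32 * ((P.d : ℝ) + 1) * P.L * ((P.L : ℝ) ^ n * b) ≤ 1 := (mul_le_mul_of_nonneg_right h ht).trans hn
  constructor <;> nlinarith

end Small

/-! ## §3 Unitarity of the frames and the guard along the iteration -/

section Unitary

variable [NeZero N]

/-- **The guard holds for a `U(N)`-valued configuration with bond variables within `δ` of `1`, `2(d+1)L·δ ≤ 1/4`** (the loop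
`Γ_{c,x} ∪ (−Γ_c)` has `2|x − c₋| + 2L ≤ 2(d+1)L` bonds; b09's `norm_hol_sub_one_le`). [cite: Balaban1985Averaging, (42) p.23, p.25] -/
theorem guard_of_small {W : (Fin P.d → ℤ) → Fin P.d → (Mat N)ˣ} (hW : ∀ x κ, W x κ ∈ unitaryUnits (Mat N)) {δ : ℝ}
    (hδ : ∀ x κ, ‖((W x κ : (Mat N)ˣ) : Mat N) - 1‖ ≤ δ) (hsmall : 2 * ((P.d : ℝ) + 1) * P.L * δ ≤ 1 / 4)
    (q : Fin P.d → ℤ) (κ : Fin P.d) : Guard P N W q κ := by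
  letI : CStarAlgebra (Mat N) := {}
  have hW1 : ∀ x κ, W x κ ∈ U1 (Mat N) := fun x κ => unitaryUnits_le_U1 (hW x κ)
  have hδ0 : 0 ≤ δ := (norm_nonneg _).trans (hδ 0 ⟨0, P.hd⟩)
  intro r
  rw [Wcx_eq_hol_loop]
  calc ‖((hol W q (gammaWord P.L κ (boxVec P.L r) ++ seg κ (-(P.L : ℤ))) : (Mat N)ˣ) : Mat N) - 1‖
      ≤ (gammaWord P.L κ (boxVec P.L r) ++ seg κ (-(P.L : ℤ))).length * δ := B9Eq315QLipschitz.norm_hol_sub_one_le hW1 hδ _ _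
    _ ≤ (2 * ((P.d : ℝ) + 1) * P.L) * δ := by
        refine mul_le_mul_of_nonneg_right ?_ hδ0
        rw [List.length_append, length_gammaWord, length_seg, Int.natAbs_neg, Int.natAbs_natCast]
        have h1 : (l1 (boxVec P.L r) : ℝ) ≤ P.d * P.L := by exact_mod_cast l1_boxVec_le P.L r
        push_cast
        nlinarith
    _ ≤ 1 / 4 := hsmall

/-- **The block frame (110) of a `U(N)`-valued configuration with bond variables within `δ` of `1`, `dL·δ ≤ 1/4`, is unitary**
(the logarithms of the tree-contour transports are skew-adjoint, (22)–(23) p. 21; b07's `star_mlog_eq_neg`, Mathlib `NormedSpace.exp_mem_unitary_of_mem_skewAdjoint`). [cite: Balaban1985Averaging, (110) p.34, (22)–(23) p.21] -/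
theorem vframe_mem {W : (Fin P.d → ℤ) → Fin P.d → (Mat N)ˣ} (hW : ∀ x κ, W x κ ∈ unitaryUnits (Mat N)) {δ : ℝ}
    (hδ : ∀ x κ, ‖((W x κ : (Mat N)ˣ) : Mat N) - 1‖ ≤ δ) (hsmall : (P.d * P.L : ℝ) * δ ≤ 1 / 4) (q : Fin P.d → ℤ) :
    vframe P.L W q ∈ unitaryUnits (Mat N) := by
  letI : CStarAlgebra (Mat N) := {}
  have hW1 : ∀ x κ, W x κ ∈ U1 (Mat N) := fun x κ => unitaryUnits_le_U1 (hW x κ)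
  have hδ0 : 0 ≤ δ := (norm_nonneg _).trans (hδ 0 ⟨0, P.hd⟩)
  have hF : Favg P.L W q ∈ skewAdjoint (Mat N) := by
    unfold Favg
    refine sum_mem fun r _ => skewAdjoint.smul_mem _ ?_
    rw [skewAdjoint.mem_iff]
    refine star_mlog_eq_neg ((mem_unitaryUnits).1 (hol_mem_of hW _ _)) ?_
    calc ‖((hol W q (treeWord (boxVec P.L r)) : (Mat N)ˣ) : Mat N) - 1‖
        ≤ (treeWord (boxVec P.L r)).length * δ := B9Eq315QLipschitz.norm_hol_sub_one_le hW1 hδ _ _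
      _ ≤ (P.d * P.L : ℝ) * δ := by
          refine mul_le_mul_of_nonneg_right ?_ hδ0
          rw [length_treeWord]; exact_mod_cast l1_boxVec_le P.L r
      _ ≤ 1 / 4 := hsmall
  letI : NormedAlgebra ℚ (Mat N) := NormedAlgebra.restrictScalars ℚ ℂ (Mat N)
  rw [mem_unitaryUnits, vframe, val_expUnit]
  exact NormedSpace.exp_mem_unitary_of_mem_skewAdjoint hF

variable {B : (Fin P.d → ℤ) → Fin P.d → Mat N} {b : ℝ} {n : ℕ}

/-- **THE ITERATION ON THE SMALL-FIELD DOMAIN** (induction on `i ≤ n`): for `U̿^0 = e^{B}` `U(N)`-valued with `sup‖B‖ ≤ b`,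
`C₃L^nb ≤ 1`: (a) every double-bar iterate `U̿^i` (90)–(91) is `U(N)`-valued, (b) the accumulated gauge transformation `g_i` is
`U(N)`-valued, and (c) the `i`-fold iterate of the centre-covariant step IS the gauge transform of `U̿^i` by `g_i`:
`citer (e^B) i = (U̿^i)^{g_i}` — (159) p. 42 «Ū^k = (U̿^k)^{v_k}» in Setup's centred convention, every guard being met. [cite: Balaban1985Averaging, (159)–(160) p.42, (92) p.31, (45) p.24] -/
theorem citer_eq_gaugeAct_dbavgIter (hBu : ∀ x κ, expCfg B x κ ∈ unitaryUnits (Mat N)) (hb : 0 ≤ b)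
    (hB : ∀ x κ, ‖B x κ‖ ≤ b) (hn : C3 P.d P.L * ((P.L : ℝ) ^ n * b) ≤ 1) :
    ∀ i ≤ n, (∀ z κ, dbavgIter P.L (expCfg B) i z κ ∈ unitaryUnits (Mat N)) ∧
      (∀ z, gacc P N (expCfg B) i z ∈ unitaryUnits (Mat N)) ∧
      citer P N (expCfg B) i = gaugeAct (gacc P N (expCfg B) i) (dbavgIter P.L (expCfg B) i) := by
  letI : CStarAlgebra (Mat N) := {}
  obtain ⟨hs1, hs2⟩ := small_of_C3 (P := P) hb hn
  intro i
  induction i with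
  | zero =>
    intro _
    refine ⟨fun z κ => hBu z κ, fun z => (unitaryUnits (Mat N)).one_mem, ?_⟩
    funext z κ
    simp [gaugeAct]
  | succ i ih =>
    intro hi
    obtain ⟨hD, hg, heq⟩ := ih (Nat.le_of_succ_le hi)
    have hδ : ∀ x κ, ‖((dbavgIter P.L (expCfg B) i x κ : (Mat N)ˣ) : Mat N) - 1‖ ≤ 4 * ((P.L : ℝ) ^ n * b) :=
      fun x κ => norm_dbavgIter_sub_one_le hb hB hn (Nat.le_of_succ_le hi) x κ
    have hfr : ∀ q, vframe P.L (dbavgIter P.L (expCfg B) i) q ∈ unitaryUnits (Mat N) := fun q =>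
      vframe_mem hD hδ hs1 q
    have hguardD : ∀ q κ, Guard P N (dbavgIter P.L (expCfg B) i) q κ := fun q κ => guard_of_small hD hδ hs2 q κ
    have hciter : ∀ x κ, citer P N (expCfg B) i x κ ∈ unitaryUnits (Mat N) := citer_mem hBu i
    refine ⟨fun z κ => ?_, fun z => ?_, ?_⟩
    · -- `U̿^{i+1}(c) = v(c₋)⁻¹ V̄(c) v(c₊)`, all three unitary
      rw [dbavgIter_succ, dbavg]
      exact (unitaryUnits (Mat N)).mul_mem ((unitaryUnits (Mat N)).mul_mem ((unitaryUnits (Mat N)).inv_mem (hfr _))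
        (bavg_mem_unitaryUnits hD P.L _ κ (hguardD _ κ))) (hfr _)
    · rw [gacc_succ]
      exact (unitaryUnits (Mat N)).mul_mem ((unitaryUnits (Mat N)).mul_mem (frameTr_mem hciter z) (hg _)) (hfr _)
    · funext z κ
      rw [citer_succ, heq, cstep, gb, if_pos ((guard_gaugeAct hg _ _ κ).2 (hguardD _ κ)),
        B7Prop6Flat.bavg_gaugeAct_units, bavg_eq_conj_dbavg, ← heq]
      simp only [gaugeAct, gacc_succ, dbavgIter_succ, smul_add, mul_inv_rev, mul_assoc]

end Unitary

/-! ## §4 The torus iterates: `(avgB7ⁿ V)~ = citer Ṽ n` -/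

section Torus

variable [NeZero N]

/-- **THE LIFT INTERTWINES THE ITERATED TORUS AVERAGING WITH THE ITERATED STEP**: in the standing range `k + n ≤ m + K`,
`(iterFrom avgB7 k n V)~ = citer Ṽ n` on `ℤ^d`. [folklore] -/
theorem liftCfg_iterFrom {k : ℕ} (V : GaugeField P k (Matrix.unitaryGroup (Fin N) ℂ)) :
    ∀ (n : ℕ), k + n ≤ P.m + P.K → liftCfg (iterFrom (avgB7 P N) k n V) = citer P N (liftCfg V) n
  | 0, _ => rfl
  | n + 1, hn => by
    rw [iterFrom_succ, citer_succ, ← liftCfg_iterFrom V n (Nat.le_of_succ_le hn)]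
    exact liftCfg_avgB7 (by omega) _

end Torus


/-! ## §5 The objects of the `FramedBondLip` instance (file 20): domain radius, domain, logarithmic coordinates, frame map -/

section Objects

/-- The radius `ρ_k = 1 / (2·C₃(d,L)·L^{m+K−k})` of the level-`k` domain — chosen so that the logarithmic coordinates
`B_b = log V_b` satisfy b07's smallness `C₃·L^n·sup‖B‖ ≤ 1` for EVERY admissible number `n ≤ m + K − k` of further averaging steps (b07's polydisc of Prop. 5; Bałaban-style constants, census R44∕R46). [cite: Balaban1985Averaging, Prop. 5 p.42, (158) p.42] -/
def rho (P : Params) (k : ℕ) : ℝ := 1 / (2 * C3 P.d P.L * (P.L : ℝ) ^ (P.m + P.K - k))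

variable (P N) in
/-- THE SMALL-FIELD DOMAIN FAMILY: level-`k` configurations all of whose bond variables are within `ρ_k` of `1` (operator norm (19)) — a sup-ball, the KIND of the small-field conditions of the series (cell typing; the printed (158)-boxes ∕ (1.100) radius are not matched numerically). [cite: Balaban1985Averaging, (158) p.42, (19) p.21] -/
def dom : ∀ j, Set (GaugeField P j (Matrix.unitaryGroup (Fin N) ℂ)) :=
  fun j => {V | ∀ b, ‖((V b : Matrix.unitaryGroup (Fin N) ℂ) : Mat N) - 1‖ ≤ rho P j}

/-- The logarithmic coordinates `B = log Ṽ` (the series (21), `MatrixLog.mlog`) of the lift of a torus configuration ((109) p. 34: `V = e^{A}` bondwise). [cite: Balaban1985Averaging, (21) p.21, (109) p.34] -/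
def logCfg {k : ℕ} (V : GaugeField P k (Matrix.unitaryGroup (Fin N) ℂ)) : (Fin P.d → ℤ) → Fin P.d → Mat N :=
  fun x κ => mlog ((liftCfg V x κ : (Mat N)ˣ) : Mat N)

open Classical in
/-- A unit of `M_N(ℂ)` read in `U(N)` (identity on unitaries, junk `1` otherwise). [folklore] -/
def toG (X : (Mat N)ˣ) : Matrix.unitaryGroup (Fin N) ℂ := if h : (X : Mat N) ∈ unitary (Mat N) then ⟨X, h⟩ else 1

variable (P N) in
/-- THE FRAME MAP of `FramedBondLip` for `avgB7`: the inverse of the accumulated gauge transformation `g_n` of the lift, read on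
the coarse torus ((159)–(160): in the frame `v_k⁻¹` the `k`-fold average is the double-bar average). [cite: Balaban1985Averaging, (159)–(160) p.42] -/
def frB7 (k n : ℕ) (V : GaugeField P k (Matrix.unitaryGroup (Fin N) ℂ)) :
    GaugeTransf P (k + n) (Matrix.unitaryGroup (Fin N) ℂ) :=
  fun y => toG ((gacc P N (liftCfg V) n (tlift y))⁻¹)

end Objects

end Summit.QuantumFields.BalabanUV.T4Continuum.Spine.NE7.TorusB7

end
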